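import Mathlib

/-!
# STUB-IDEAS k1 (gen 46) — typed sketch for `stub_heegnerIndexLowerAtTwo`
# «UNRAMIFY THE CHARACTER, RAMIFY THE BASE» — weaken/strengthen census of HARDEST (a) along the
# character-ramification axis, value side (K69 covers the algebraic dress).

HONEST FRAMING.  Nothing here proves BSD, the crux `PrintCf2.SplitBadTwoLowerHalfOfFacts`, or the stub.
This file is `import Mathlib` only; it contains (i) a kernel-checked TOY of the forced-zero mechanism
(N1): an analytic germ at `j = -1` in `ℚ_[2]` that vanishes at the in-range odd weights `j_m = 2^m - 1`
vanishes at the out-of-range point `j = -1`; (ii) the Katz-range and sign bookkeeping behind (N2);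
(iii) the digit identities showing what the surviving weight-one object would carry.  The research
statements (N1), (N2), (P) live in the card `idea-stub-heegnerindexloweratwo-k1-g46.md` as prose with
sources; the `Prop`s below only FIX THEIR SHAPE and are marked UNPRINTED where they are.
-/

namespace Summit.BirchSwinnertonDyer.BirchSwinnertonDyer.Cruxes.SplitBadTwoLowerHalfOfFacts.UnramifyBaseK1G46

open Filter Topology

/-! ## (i) N1-toy: Greenberg's forced zero reaches the out-of-range point on the same 2-adic branch -/

/-- The in-range odd weights `j_m = 2^m - 1` tend 2-adically to the out-of-range point `j = -1`. -/
theorem tendsto_oddWeights_neg_one :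
    Tendsto (fun m : ℕ => (2 : ℚ_[2]) ^ m - 1) atTop (𝓝 (-1)) := by
  have h2 : ‖(2 : ℚ_[2])‖ < 1 := by
    simpa using Padic.norm_p_lt_one (p := 2)
  have h0 := (tendsto_pow_atTop_nhds_zero_of_norm_lt_one h2).sub_const 1
  simpa using h0

/-- No in-range odd weight IS the out-of-range point. -/
theorem oddWeight_ne_neg_one (m : ℕ) : (2 : ℚ_[2]) ^ m - 1 ≠ -1 := by
  intro h
  have h' : (2 : ℚ_[2]) ^ m = 0 := by linear_combination h
  exact absurd h' (pow_ne_zero _ two_ne_zero)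

/-- **(N1-toy) forced zero at the out-of-range point.**  If a 2-adic analytic germ `f` at `j = -1`
(model: the restriction of a bounded branch function to the self-dual line of a RANK-ZERO CM character,
odd branch) vanishes at every in-range odd weight `j_m = 2^m - 1`, `m ≥ 1` (model: root number
`(-1)^j · w(ν) = -1` for odd `j` when `w(ν) = +1`), then `f(-1) = 0` (model: the out-of-range value
`𝓛(ν*)`, `ν* = ν̄ = φ_{-1}`, vanishes).  Identity theorem in `ℚ_[2]`. -/
theorem forcedZero_at_neg_one {f : ℚ_[2] → ℚ_[2]} (hf : AnalyticAt ℚ_[2] f (-1))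
    (hzero : ∀ m : ℕ, 1 ≤ m → f ((2 : ℚ_[2]) ^ m - 1) = 0) : f (-1) = 0 := by
  have htend : Tendsto (fun m : ℕ => (2 : ℚ_[2]) ^ m - 1) atTop (𝓝[≠] (-1)) :=
    tendsto_nhdsWithin_iff.mpr
      ⟨tendsto_oddWeights_neg_one, Eventually.of_forall fun m => oddWeight_ne_neg_one m⟩
  have hev : ∀ᶠ m : ℕ in atTop, f ((2 : ℚ_[2]) ^ m - 1) = 0 :=
    eventually_atTop.mpr ⟨1, hzero⟩
  have hfreq : ∃ᶠ z in 𝓝[≠] (-1 : ℚ_[2]), f z = 0 := htend.frequently hev.frequently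
  exact (hf.frequently_zero_iff_eventually_zero.mp hfreq).self_of_nhds

/-- Digit form of (N1): the Artin lift of the out-of-range value along `K₀ ⊂ L_q = K₀·ℚ(√D_q)` is the
PRODUCT `val_W · val_{A'_q}`; when the auxiliary good twin `A'_q` has analytic rank `0` its factor is the
forced zero, so the lifted value is `0` WHATEVER `val_W` is — it constrains nothing. -/
theorem artinLift_uninformative (c : ℚ_[2]) :
    ∃ valW valA : ℚ_[2], valA = 0 ∧ valW * valA = 0 ∧ valW = c :=
  ⟨c, 0, rfl, mul_zero c, rfl⟩

/-! ## (ii) N2 bookkeeping: Katz range and archimedean signs over the real quadratic base `F_q` -/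

/-- Katz's interpolation range for the `K₀`-induced (2-ordinary) CM type `Σ` of the quartic CM field
`L_q = K₀·F_q`: infinity type `k·Σ + d₁(σ₁ - σ̄₁) + d₂(σ₂ - σ̄₂)` (our sign convention) is interpolated
iff `k ≥ 1` and `d₁, d₂ ≥ 0` (Katz 1978 (5.3.0); Hida–Tilouine 1993 §4). -/
def InKatzRange (k d₁ d₂ : ℤ) : Prop := 1 ≤ k ∧ 0 ≤ d₁ ∧ 0 ≤ d₂

/-- The FIRST Rankin constituent `Ψ₀·Χ'·χ_{(j₁,j₂)}` has `(k, d₁, d₂) = (1, j₁, j₂)`. -/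
def firstConstituent (j₁ j₂ : ℤ) : ℤ × ℤ × ℤ := (1, j₁, j₂)

/-- The SECOND Rankin constituent `Ψ₀ᶜ·Χ'·χ_{(j₁,j₂)}` has, relative to the same ordinary type,
`(k, d₁, d₂) = (1, j₁ - 1, j₂ - 1)` (the BDP–PJM shift, one unit per infinite place). -/
def secondConstituent (j₁ j₂ : ℤ) : ℤ × ℤ × ℤ := (1, j₁ - 1, j₂ - 1)

theorem firstConstituent_inRange {j₁ j₂ : ℤ} (h₁ : 0 ≤ j₁) (h₂ : 0 ≤ j₂) :
    InKatzRange (firstConstituent j₁ j₂).1 (firstConstituent j₁ j₂).2.1 (firstConstituent j₁ j₂).2.2 :=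
  ⟨le_refl 1, h₁, h₂⟩

/-- Both constituents are interpolated iff `j₁ ≥ 1 ∧ j₂ ≥ 1` — the open quadrant. -/
theorem secondConstituent_inRange_iff (j₁ j₂ : ℤ) :
    InKatzRange (secondConstituent j₁ j₂).1 (secondConstituent j₁ j₂).2.1
      (secondConstituent j₁ j₂).2.2 ↔ 1 ≤ j₁ ∧ 1 ≤ j₂ := by
  simp only [InKatzRange, secondConstituent, le_refl, true_and]
  omega

/-- **(N2, range half)** On the Shimura-curve family (`B/F_q` ramified at `σ₂`, so `j₂ = 0` is forced by
the definite local torus at `σ₂`), the second constituent is NEVER in Katz's range: `d₂ = -1`.  Hence no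
point of that one-variable family admits the BDP–PJM factorisation into two interpolated Katz values. -/
theorem shimuraCurveFamily_no_factorisation (j₁ : ℤ) :
    ¬ InKatzRange (secondConstituent j₁ 0).1 (secondConstituent j₁ 0).2.1
        (secondConstituent j₁ 0).2.2 := by
  rw [secondConstituent_inRange_iff]; omega

/-- Archimedean sign bookkeeping: the global root number of `L(θ_{Ψ₀} × Χ'χ_{(j₁,j₂)}, s)` at the centre
is `s₀ · (-1)^{[j₁ ≥ 1] + [j₂ ≥ 1]}` — one flip per real place at which the weight of the character
(`2jᵢ + 1`) exceeds the weight `2` of the form. -/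
def famSign (s₀ : ℤ) (j₁ j₂ : ℕ) : ℤ :=
  s₀ * (if 1 ≤ j₁ then -1 else 1) * (if 1 ≤ j₂ then -1 else 1)

/-- **(N2, sign half)** In the incoherent lifted setting (`s₀ = -1`: total order of vanishing `1`), the
joint Katz range `j₁, j₂ ≥ 1` is exactly the region of root number `-1`: every interpolated central value
there is a forced zero, so the two-variable square-root function is `≡ 0` — consistent with (N1). -/
theorem famSign_quadrant {j₁ j₂ : ℕ} (h₁ : 1 ≤ j₁) (h₂ : 1 ≤ j₂) : famSign (-1) j₁ j₂ = -1 := by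
  simp [famSign, h₁, h₂]

/-- … while on the Shimura-curve half-line `j₂ = 0` the sign is `+1` (generic non-vanishing; this is the
family whose value at `j₁ = 0` is the weight-ONE object `G_F(0) = e·log_𝔮 P` of (P)) — but by
`shimuraCurveFamily_no_factorisation` it is tied to no `K₀`-Katz value. -/
theorem famSign_halfLine {j₁ : ℕ} (h₁ : 1 ≤ j₁) : famSign (-1) j₁ 0 = 1 := by
  simp [famSign, h₁]

theorem famSign_centre : famSign (-1) 0 0 = -1 := by simp [famSign]

/-! ## (iii) digits: what the surviving weight-one object would carry, and why LOWER cannot cash it -/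

/-- The lifted Heegner point `P` on `W/F_q` has `W(ℚ)`-component `β·P_gen` with
`v(β) = i_ℚ + r`, `2r = a + m + c₁` (`a = v₂ L_alg(A'_q,1)`, `m = v₂ L_alg(μ_L,1)`): the weight-one carrier
`v₂ G_F(0) = v(e) + v(β) + v₂ log P_gen` contains the Heegner digit ONCE.  LOWER's one-sided `x`-law
needs `v₂(val_W) ≥ 2x + κ`; with no identity linking `G_F(0)²` to `val_W` ((N1)+(N2)) the carrier gives
`val_W` no bound: for every candidate valuation `v` of `val_W` the digits are consistent. -/
theorem weightOne_carrier_gives_no_bound (i r ve vlog : ℤ) (v : ℤ) :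
    ∃ vG vβ : ℤ, vβ = i + r ∧ vG = ve + vβ + vlog ∧ (v ≤ 2 * vG ∨ 2 * vG < v) :=
  ⟨ve + (i + r) + vlog, i + r, rfl, rfl, by omega⟩

/-! ## Shapes of the research statements (prose + sources in the card; UNPRINTED where marked) -/

/-- (N1) shape — «rank-zero good CM twin ⇒ out-of-range Katz value on the odd self-dual branch is `0`».
Inputs in print: root numbers `w(ν^{1+2j}) = (-1)^j w(ν)` (Rohrlich; Rodriguez-Villegas 1993), Katz /
de Shalit boundedness of the branch function, identity theorem (`forcedZero_at_neg_one` is its kernel);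
corroboration: Rubin 1992 (points of infinite order from `L_𝔭(ψ*) ≠ 0`).  Recorded as a `Prop` shape only. -/
def OutOfRangeValueVanishesInRankZero : Prop :=
  ∀ (f : ℚ_[2] → ℚ_[2]), AnalyticAt ℚ_[2] f (-1) →
    (∀ m : ℕ, 1 ≤ m → f ((2 : ℚ_[2]) ^ m - 1) = 0) → f (-1) = 0

theorem outOfRangeValueVanishesInRankZero_holds : OutOfRangeValueVanishesInRankZero :=
  fun _ hf hz => forcedZero_at_neg_one hf hz

/-- (P) shape, UNPRINTED at `p = 2` with `2` ramified in the real quadratic base: «p-adic Waldspurger on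
the Shimura curve `X_B/F_q` at the prime `𝔮 | 2` (form, character and CM points unramified / ordinary at
`𝔮`): `G_F(0) = e(𝔮)·log_𝔮 P_{Χ'}`» (shape of BDP 2013 Thm 5.13 / Brooks 2015 Thm 1.1 / Liu–Zhang–Zhang
2018 over `ℚ`; over totally real `F` with `p` unramified in `F`: the literature's standing hypothesis).
Only its SHAPE is fixed here: a value `G0`, a unit-like factor `e ≠ 0`, a logarithm. -/
def ShimuraCurveWaldspurgerAtRamifiedBaseShape (G0 e logP : ℚ_[2]) : Prop := e ≠ 0 ∧ G0 = e * logP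

/-- From the shape alone: `G_F(0) ≠ 0 ↔ log P ≠ 0` (non-torsion lifted Heegner point, YZZ) — so (P) is
NOT contradicted by (N1): the vanishing object in (N1)/(N2) is the two-variable Katz-factorised function,
not `G_F`. -/
theorem shape_nonvanishing {G0 e logP : ℚ_[2]} (h : ShimuraCurveWaldspurgerAtRamifiedBaseShape G0 e logP) :
    G0 ≠ 0 ↔ logP ≠ 0 := by
  obtain ⟨he, rfl⟩ := h
  simp [he]

end Summit.BirchSwinnertonDyer.BirchSwinnertonDyer.Cruxes.SplitBadTwoLowerHalfOfFacts.UnramifyBaseK1G46
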